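import Literature.MathematicalPhysics.KineticTheory.LangevinChainH2Proof
import Literature.MathematicalPhysics.KineticTheory.LangevinChainKernelDensity
import HarnessLib

/-!
# Cuneo–Eckmann–Hairer–Rey-Bellet 2018, Thm 2.13 (weak corollary, pinned chain), proved:
`CuneoEckmannHairerReyBellet2018_pinnedChain_holds`

Topic `Literature/MathematicalPhysics/KineticTheory` (discharge of the named fact
`HeatConduction.CuneoEckmannHairerReyBellet2018_pinnedChain` of `LangevinChainNESS.lean`, a
tier-1 cone fact of the summit `AtomisticToContinuum`, conjunct `FouriersLaw`: it is the
existence half of clause (i) of `OscillatorChain.FouriersLawFor` and the first hypothesis of the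
route assembly `Assembly3` of `Summits/AtomisticToContinuum/FouriersLaw/Theses/FourierGreenKubo`).

The fact — for `pinnedChain ω₂ lam β γ` with all parameters positive, every `N ≥ 1` and all
`T_L, T_R > 0` there is a weak (Fokker–Planck) steady state, absolutely continuous, integrating
`e^{ϑH}` for `0 < ϑ < 1/max(T_L,T_R)` — is obtained by joining two results already in the tree:

* `CuneoEckmannHairerReyBellet2018_pinnedChain_of_H2` (`LangevinChainKernelDensity.lean`): the fact
  follows from the Lyapunov condition H2 for `V = e^{θH}` (CEHR Thm 5.1 / Rem 5.2) alone — the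
  invariant probability measure of the constructed transition semigroup (Krylov–Bogoliubov) is a
  weak steady state by Dynkin's identity, and is absolutely continuous because the time-one
  transition probabilities are (`pinnedChain_transitionKernel_one_absolutelyContinuous`);
* `CuneoEckmannHairerReyBellet2018_H2_holds` (`LangevinChainH2Proof.lean`): H2, proved.

The result is unconditional (axioms `propext`, `Classical.choice`, `Quot.sound` only). No new
definitions. UNIQUENESS of the weak steady state (the other half of clause (i), route item
`NessUnique`) is not addressed here.

## References

* [CuneoEckmannHairerReyBellet2018] N. Cuneo, J.-P. Eckmann, M. Hairer, L. Rey-Bellet,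
  *Non-equilibrium steady states for networks of oscillators*, Electron. J. Probab. 23 (2018),
  no. 55, arXiv:1712.09413: Thm 2.13, Thm 5.1, Rem 5.2, Prop 3.2.
* [BonettoLebowitzReyBellet2000] F. Bonetto, J. L. Lebowitz, L. Rey-Bellet, *Fourier's law: a
  challenge to theorists*, in: Mathematical Physics 2000, Imperial College Press, 128–150,
  arXiv:math-ph/0002052: §5.1 item 1 (existence of the SNS).
-/

noncomputable section

namespace Literature.MathematicalPhysics.KineticTheory.HeatConduction

/-- **Cuneo–Eckmann–Hairer–Rey-Bellet 2018, Theorem 2.13 (weak-stationarity corollary for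
the pinned anharmonic chain), proved.** For `pinnedChain ω₂ lam β γ`
(`U(q) = ω₂q²/2 + lam q⁴/4`, `V(r) = r²/2 + βr⁴/4`) with `ω₂, lam, β, γ > 0`, every `N ≥ 1` and
all `T_L, T_R > 0` there is a probability measure on phase space which is a steady state in the
weak Fokker–Planck sense (`OscillatorChain.IsSteadyState`: `∫ L f dμ = 0` for smooth compactly
supported `f`, bond currents integrable), is absolutely continuous with respect to Lebesgue
measure, and integrates `e^{ϑH}` for every `0 < ϑ < 1/max(T_L, T_R)`: H2
(`CuneoEckmannHairerReyBellet2018_H2_holds`) fed into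
`CuneoEckmannHairerReyBellet2018_pinnedChain_of_H2`.
[cite: CuneoEckmannHairerReyBellet2018, Thm 2.13] -/
theorem CuneoEckmannHairerReyBellet2018_pinnedChain_holds :
    CuneoEckmannHairerReyBellet2018_pinnedChain :=
  CuneoEckmannHairerReyBellet2018_pinnedChain_of_H2 CuneoEckmannHairerReyBellet2018_H2_holds

/-- Hence clause (i)-existence of `FouriersLawFor` for the pinned chain at every length,
`N = 0` included (the empty chain carries the point mass, `OscillatorChain.isSteadyState_zero`).
[cite: CuneoEckmannHairerReyBellet2018, Thm 2.13] -/
theorem pinnedChain_exists_isSteadyState {ω₂ lam β γ : ℝ} (hω : 0 < ω₂) (hl : 0 < lam)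
    (hβ : 0 < β) (hγ : 0 < γ) (N : ℕ) {T_L T_R : ℝ} (hL : 0 < T_L) (hR : 0 < T_R) :
    ∃ μ : MeasureTheory.Measure (PhaseSpace N),
      (pinnedChain ω₂ lam β γ).IsSteadyState N T_L T_R μ := by
  rcases Nat.eq_zero_or_pos N with rfl | hN
  · exact ⟨_, OscillatorChain.isSteadyState_zero _ T_L T_R⟩
  · exact CuneoEckmannHairerReyBellet2018_pinnedChain_holds.exists_isSteadyState
      hω hl hβ hγ hN hL hR

end Literature.MathematicalPhysics.KineticTheory.HeatConduction

end
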